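import Summits.QuantumAdvantage.AdviceFreeQNC0.RingKernel
import HarnessLib

/-!
# Cell qa-qnc0 — the canonical degree-1 strategy `t_j = x_j ⊕ x_{j+1}` on the ring (all `n`)

Planner qa-qnc0-p1's structure theorem K6 (F1)/(F2) (`HOME/qa-qnc0-p1/TARGET.md`, exhaustive for
ring lengths `6 … 12` there), now for EVERY `n ≥ 3`: the affine output map
`t(x)_j = x_j ⊕ x_{j+1}` (`tGuess`, `𝔽₂`-degree `1`) solves the ring relation `RingHLF.Rel x ·`
EXACTLY when the number of zeros of `x` is even, and on every pattern with an odd number of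
zeros it violates the constraint of the kernel line `v⋆(x)` of `RingKernel.kernel_odd`
(`⟨t, v⋆⟩ = ℓ_x(v⋆) + 1`):

* `rel_tGuess_iff` — `Rel x (tGuess x) ↔ reflBit (List.ofFn x) = false` (`↔` even number of
  zeros, `RingKernel.reflBit_ofFn_iff`).

So a classical solver only has work to do on the odd ("transposition") class — p1's reformulation
"bet with odd total stake against a `MOD₃` residue", p2's eigenline problem — and degree `1`
already achieves failure probability exactly `1/2`.

Method: an AUGMENTED dictionary theorem. Along the transfer-matrix walk of `RingKernel` the
quantity `Q = 2⟨t,v⟩ − 2·#edges(supp v) − |x ∧ v| (mod 4)` is accumulated from local terms in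
(letter, state); `augFold_eq` shows `(final state, Q) = (dict, qtab)(reflBit, sigmaSum, s_0)`
for an explicit `24`-entry table `qtab` (one induction + a `decide`-checked step identity), and
validity of `t` against a kernel vector is `Q ≡ 0 (mod 4)`.

WHAT THIS IS NOT: nothing about strategies of degree `≥ 2` (p2's `zSixth` 5/6-map and
`SixthMapLaw` are the next rung); no counting of the even class (`= 2^{n−1}` patterns).
-/

namespace Summit.QuantumAdvantage.AdviceFreeQNC0

open Finset Literature.Computability.QuantumComplexity Literature.Computability.QuantumComplexity.RingHLF

variable {n : ℕ}

/-- The canonical degree-1 guess `t_j = x_j ⊕ x_{j+1}` (planner qa-qnc0-p1's `ringT`). -/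
def tGuess (x : Fin n → Bool) (j : Fin n) : Bool := xor (x j) (x (nxt j))

/-! ### The augmented walk -/

/-- Indicator of a Boolean in `ℤ/4`. -/
def ind4 (b : Bool) : ZMod 4 := if b then 1 else 0

/-- Local contribution of letter `b` at state `s = (v_{j−1}, v_j)` to
`Q = 2⟨t,v⟩ − 2·#edges − |x ∧ v|`: `2[b ∧ (v_{j−1} ⊕ v_j)] − 2[v_{j−1} ∧ v_j] − [b ∧ v_j]`. -/
def localQ (b : Bool) (s : St) : ZMod 4 :=
  2 * ind4 (b && xor s.1 s.2) - 2 * ind4 (s.1 && s.2) - ind4 (b && s.2)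

/-- One augmented step. -/
def augStep (b : Bool) (sq : St × ZMod 4) : St × ZMod 4 := (tstep b sq.1, sq.2 + localQ b sq.1)

/-- The augmented walk along a word. -/
def augFold (l : List Bool) (sq : St × ZMod 4) : St × ZMod 4 := l.foldl (fun sq b => augStep b sq) sq

/-- The table of accumulated `Q (mod 4)` as a function of the dictionary data
(reflection bit, signed count) and the initial state (found by exhaustion, proved by induction). -/
def qtab (rb : Bool) (S : ZMod 3) (s : St) : ZMod 4 :=
  match rb, s with
  | false, (false, false) => 0
  | false, (false, true) => if S = 0 then 0 else if S = 1 then 1 else 2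
  | false, (true, false) => if S = 0 then 0 else if S = 1 then 2 else 3
  | false, (true, true) => if S = 0 then 0 else if S = 1 then 1 else 3
  | true, (false, false) => 0
  | true, (false, true) => if S = 0 then 3 else if S = 1 then 0 else 2
  | true, (true, false) => if S = 0 then 2 else if S = 1 then 0 else 1
  | true, (true, true) => if S = 0 then 1 else if S = 1 then 2 else 3

/-- The augmented step identity (finite check). -/
theorem qtab_step : ∀ (b rb : Bool) (S : ZMod 3) (s : St),
    localQ b s + qtab rb S (tstep b s) = qtab (xor rb (!b)) (S + (if rb then -1 else 1)) s := by
  decide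

/-- The accumulator enters additively. -/
theorem augFold_shift (l : List Bool) (s : St) (q : ZMod 4) :
    augFold l (s, q) = ((augFold l (s, 0)).1, q + (augFold l (s, 0)).2) := by
  induction l generalizing s q with
  | nil => simp [augFold]
  | cons b rest ih =>
    simp only [augFold, List.foldl_cons, augStep] at ih ⊢
    rw [ih (tstep b s) (q + localQ b s), ih (tstep b s) (0 + localQ b s)]
    ext <;> simp [add_assoc]

/-- **Augmented dictionary theorem**: `augFold l (s, 0) = (dict rb S s, qtab rb S s)` with
`(rb, S) = (reflBit l, sigmaSum l)`. -/
theorem augFold_eq : ∀ (l : List Bool) (s : St),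
    augFold l (s, 0) = (dict (reflBit l) (sigmaSum l) s, qtab (reflBit l) (sigmaSum l) s)
  | [], s => by
      simp only [augFold, List.foldl_nil, reflBit, sigmaSum]
      revert s; decide
  | b :: rest, s => by
      have h1 : augFold (b :: rest) (s, 0) = augFold rest (tstep b s, localQ b s) := by
        simp [augFold, augStep]
      rw [h1, augFold_shift, augFold_eq rest (tstep b s)]
      simp only
      rw [dict_tstep, qtab_step, reflBit, sigmaSum]

/-! ### The accumulated quantity along the ring -/

/-- The augmented walk over a prefix of the word: state component. -/
theorem augFold_take_fst (x : Fin n → Bool) (s : St) :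
    ∀ k, k ≤ n → (augFold ((List.ofFn x).take k) (s, 0)).1 = iter x k s := by
  intro k
  induction k with
  | zero => intro _; simp [augFold, iter]
  | succ k ih =>
    intro hk
    have hk' : k < n := by omega
    have hlen : k < (List.ofFn x).length := by rw [List.length_ofFn]; exact hk'
    unfold augFold at ih ⊢
    rw [List.take_add_one, List.foldl_append, iter_succ x hk', ← ih hk'.le]
    simp [List.getElem?_eq_getElem hlen, augStep]

/-- The augmented walk over a prefix of the word: the accumulator is the sum of the local terms. -/
theorem augFold_take_snd (x : Fin n → Bool) (s : St) :
    ∀ k, (hk : k ≤ n) → (augFold ((List.ofFn x).take k) (s, 0)).2 =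
      ∑ j : Fin k, localQ (x ⟨j.val, by omega⟩) (iter x j.val s) := by
  intro k
  induction k with
  | zero => intro _; simp [augFold]
  | succ k ih =>
    intro hk
    have hk' : k < n := by omega
    have hlen : k < (List.ofFn x).length := by rw [List.length_ofFn]; exact hk'
    rw [Fin.sum_univ_castSucc]
    simp only [Fin.val_castSucc, Fin.val_last]
    rw [← ih hk'.le, ← augFold_take_fst x s k hk'.le]
    unfold augFold
    rw [List.take_add_one, List.foldl_append]
    simp [List.getElem?_eq_getElem hlen, augStep]

/-! ### From `Q` to validity of `t` -/

/-- `2·[b] (mod 4)` only depends on `b`; bookkeeping for parities. -/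
private theorem two_mul_natCast_zmod4_eq_of_mod_two {a b : ℕ} (h : a % 2 = b % 2) :
    (2 * (a : ZMod 4)) = 2 * (b : ZMod 4) := by
  have : (2 * a) % 4 = (2 * b) % 4 := by omega
  have := (ZMod.natCast_eq_natCast_iff' (2 * a) (2 * b) 4).2 this
  push_cast at this
  exact this

/-- The pairing `⟨t(x), v⟩` modulo `2` in walk form: `Σ_j [x_j ∧ (v_{j−1} ⊕ v_j)]`. -/
private theorem dot_tGuess_mod_two (x v : Fin n → Bool) :
    (univ.filter fun b : Fin n => v b = true ∧ tGuess x b = true).card % 2 =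
      (univ.filter fun j : Fin n => x j = true ∧ (xor (v (prv j)) (v j)) = true).card % 2 := by
  -- both sides are `Σ_b v_b x_b + Σ_b v_b x_{b+1}` modulo 2
  have key : ∀ (S T : Finset (Fin n)) (f g : Fin n → Bool),
      (∀ b, (b ∈ S) ↔ (xor (f b) (g b)) = true) →
      S.card % 2 = ((univ.filter fun b => f b = true).card + (univ.filter fun b => g b = true).card) % 2 := by
    intro S T f g hS
    have : S = univ.filter fun b => (xor (f b) (g b)) = true := by
      ext b; simp [hS b]
    rw [this, card_filter, card_filter, card_filter, ← sum_add_distrib, Finset.sum_nat_mod,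
      Finset.sum_congr rfl fun b _ => ?_, ← Finset.sum_nat_mod]
    cases f b <;> cases g b <;> simp
  rw [key _ ∅ (fun b => v b && x b) (fun b => v b && x (nxt b)) (fun b => by
      simp only [mem_filter, mem_univ, true_and, tGuess]
      cases v b <;> cases x b <;> cases x (nxt b) <;> simp),
    key _ ∅ (fun j => x j && v j) (fun j => x j && v (prv j)) (fun j => by
      simp only [mem_filter, mem_univ, true_and]
      cases x j <;> cases v (prv j) <;> cases v j <;> simp)]
  -- reindex the second sums: `b ↦ nxt b`
  have h1 : (univ.filter fun b : Fin n => (v b && x b) = true).card =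
      (univ.filter fun j : Fin n => (x j && v j) = true).card := by
    congr 1; ext b; simp [Bool.and_comm]
  have h2 : (univ.filter fun b : Fin n => (v b && x (nxt b)) = true).card =
      (univ.filter fun j : Fin n => (x j && v (prv j)) = true).card := by
    refine card_bij (fun b _ => nxt b) (fun b hb => ?_) (fun a _ b _ h => nxt_injective h)
      (fun j hj => ⟨prv j, ?_, nxt_prv j⟩)
    · simp only [mem_filter, mem_univ, true_and, prv_nxt] at hb ⊢
      rwa [Bool.and_comm]
    · simp only [mem_filter, mem_univ, true_and, nxt_prv] at hj ⊢
      rwa [Bool.and_comm]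
  rw [h1, h2]

/-- `#edges(supp v)` in walk form: `#{j : v_{j−1} ∧ v_j}`. -/
private theorem edgesIn_eq_prv (v : Fin n → Bool) :
    edgesIn v = (univ.filter fun j : Fin n => (v (prv j) && v j) = true).card := by
  unfold edgesIn
  refine card_bij (fun b _ => nxt b) (fun b hb => ?_) (fun a _ b _ h => nxt_injective h)
    (fun j hj => ⟨prv j, ?_, nxt_prv j⟩)
  · simp only [mem_filter, mem_univ, true_and, prv_nxt] at hb ⊢
    rw [hb.1, hb.2]; rfl
  · simp only [mem_filter, mem_univ, true_and, nxt_prv] at hj ⊢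
    revert hj; cases v (prv j) <;> cases v j <;> simp

/-- **The accumulated `Q` of a kernel vector.** For `v ∈ K(x)` with initial state
`s_0 = (v_{n−1}, v_0)`:
`2·⟨t(x), v⟩ − 2·#edges(supp v) − |x ∧ v| = qtab (reflBit x) (sigmaSum x) s_0` in `ℤ/4`. -/
theorem Q_of_inKernel (hn : 3 ≤ n) {x v : Fin n → Bool} (hv : InKernel x v) :
    (2 * ((univ.filter fun b : Fin n => v b = true ∧ tGuess x b = true).card : ZMod 4)
        - 2 * (edgesIn v : ZMod 4) - (wtAnd x v : ZMod 4)) =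
      qtab (reflBit (List.ofFn x)) (sigmaSum (List.ofFn x)) (v ⟨n - 1, by omega⟩, v ⟨0, by omega⟩) := by
  set s : St := (v ⟨n - 1, by omega⟩, v ⟨0, by omega⟩) with hs
  -- the walk computes `Q`
  have hQ := augFold_take_snd x s n le_rfl
  rw [List.take_of_length_le (by rw [List.length_ofFn]), augFold_eq] at hQ
  simp only at hQ
  rw [hQ]
  -- states along the walk are `(v_{j-1}, v_j)`
  have hst : ∀ j : Fin n, iter x j.val s = (v (prv j), v j) := by
    intro j
    rw [hs, iter_eq_of_inKernel hn hv j.val j.isLt.le]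
    refine Prod.ext ?_ ?_
    · exact congrArg v (Fin.ext rfl)
    · exact congrArg v (Fin.ext (by simp [Nat.mod_eq_of_lt j.isLt]))
  have hsum : (∑ j : Fin n, localQ (x ⟨j.val, by omega⟩) (iter x j.val s)) =
      ∑ j : Fin n, localQ (x j) (v (prv j), v j) := by
    refine sum_congr rfl fun j _ => ?_
    rw [hst j]
  rw [hsum]
  -- evaluate the three sums of local terms
  unfold localQ
  rw [sum_sub_distrib, sum_sub_distrib, ← mul_sum, ← mul_sum]
  have hind : ∀ (p : Fin n → Bool), (∑ j : Fin n, ind4 (p j)) =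
      ((univ.filter fun j : Fin n => p j = true).card : ZMod 4) := by
    intro p
    rw [natCast_card_filter]
    refine sum_congr rfl fun j _ => ?_
    unfold ind4; rfl
  rw [hind (fun j => x j && xor (v (prv j)) (v j)), hind (fun j => v (prv j) && v j),
    hind (fun j => x j && v j)]
  -- compare with the three counts
  congr 1
  · congr 1
    · apply two_mul_natCast_zmod4_eq_of_mod_two
      rw [dot_tGuess_mod_two]
      congr 2; ext j; simp
    · rw [edgesIn_eq_prv]
  · unfold wtAnd
    congr 2; ext j; simp

/-- `|x ∧ v|` is even on the ring kernel (read off the table: `Q` is even at fixed states;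
also tree `RingHLF.even_wtAnd_of_inKernel`). -/
theorem even_wtAnd_of_inKernel' (hn : 3 ≤ n) {x v : Fin n → Bool} (hv : InKernel x v) :
    Even (wtAnd x v) := by
  have hQ := Q_of_inKernel hn hv
  have hfix := monodromy_fixed_of_inKernel hn hv
  rw [monodromy_eq_dict] at hfix
  have htab : ∀ (rb : Bool) (S : ZMod 3) (s : St), dict rb S s = s →
      (qtab rb S s = 0 ∨ qtab rb S s = 2) := by decide
  have hev := htab _ _ _ hfix
  set D := (univ.filter fun b : Fin n => v b = true ∧ tGuess x b = true).card
  set E := edgesIn v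
  set A := wtAnd x v
  -- project to `ℤ/2`
  let φ : ZMod 4 →+* ZMod 2 := ZMod.castHom (show 2 ∣ 4 by norm_num) (ZMod 2)
  have hA : ((A : ℕ) : ZMod 4) = 2 * (D : ZMod 4) - 2 * (E : ZMod 4) -
      qtab (reflBit (List.ofFn x)) (sigmaSum (List.ofFn x)) (v ⟨n - 1, by omega⟩, v ⟨0, by omega⟩) := by
    linear_combination -hQ
  have h2 : φ 2 = 0 := by decide
  have hq : φ (qtab (reflBit (List.ofFn x)) (sigmaSum (List.ofFn x)) (v ⟨n - 1, by omega⟩, v ⟨0, by omega⟩)) = 0 := by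
    rcases hev with h | h <;> rw [h]
    · exact map_zero φ
    · exact h2
  have hA2 : ((A : ℕ) : ZMod 2) = 0 := by
    have := congrArg φ hA
    rw [map_natCast, map_sub, map_sub, map_mul, map_mul, map_natCast, map_natCast, h2, hq] at this
    simpa using this
  exact ZMod.natCast_eq_zero_iff_even.1 hA2

/-- **F1/F2 for all `n ≥ 3`**: the degree-1 strategy `t(x)_j = x_j ⊕ x_{j+1}` solves the ring
relation exactly iff the number of zeros of `x` is even (planner qa-qnc0-p1 K6 (F1)/(F2)). -/
theorem rel_tGuess_iff (hn : 3 ≤ n) (x : Fin n → Bool) :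
    Rel x (tGuess x) ↔ reflBit (List.ofFn x) = false := by
  constructor
  · -- odd class: the kernel line violates the constraint
    intro hrel
    by_contra hodd
    rw [Bool.not_eq_false] at hodd
    set v := kernelVec x (fixVec (sigmaSum (List.ofFn x))) with hvdef
    have hv : InKernel x v := ((kernel_odd hn x hodd v).2 (Or.inr rfl))
    have hQ := Q_of_inKernel hn hv
    have hd := hrel v hv
    unfold dot2 signBit at hd
    -- initial state of `v⋆` is the fixed vector
    have hfix : monodromy (List.ofFn x) (fixVec (sigmaSum (List.ofFn x))) =
        fixVec (sigmaSum (List.ofFn x)) := by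
      rw [monodromy_eq_dict, hodd, dict_true_fixed_iff]; exact Or.inr rfl
    have hs0 : (v ⟨n - 1, by omega⟩, v ⟨0, by omega⟩) = fixVec (sigmaSum (List.ofFn x)) := by
      refine Prod.ext ?_ ?_
      · have h1 := iter_succ_fst x (show n - 1 < n by omega) (fixVec (sigmaSum (List.ofFn x)))
        rw [show n - 1 + 1 = n by omega, iter_length, hfix] at h1
        simp only [hvdef, kernelVec]
        exact h1.symm
      · simp [hvdef, kernelVec]
    rw [hs0, hodd] at hQ
    have hQ2 : ∀ S : ZMod 3, qtab true S (fixVec S) = 2 := by decide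
    rw [hQ2] at hQ
    -- `A` even, and validity says `2 D = 2 E + A (mod 4)`: contradiction with `Q = 2`
    obtain ⟨c2, hc2⟩ := even_wtAnd_of_inKernel' hn hv
    rw [hc2] at hQ hd
    rw [show c2 + c2 = 2 * c2 by ring, Nat.mul_div_cancel_left _ (by norm_num : 0 < 2)] at hd
    set D := (univ.filter fun b : Fin n => v b = true ∧ tGuess x b = true).card
    set E := edgesIn v
    have h4 : (2 * D) % 4 = (2 * E + 2 * c2) % 4 := by omega
    have h4' := (ZMod.natCast_eq_natCast_iff' (2 * D) (2 * E + 2 * c2) 4).2 h4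
    push_cast at h4' hQ
    have h22 : (2 : ZMod 4) = 0 := by
      rw [← hQ]; linear_combination h4'
    exact absurd h22 (by decide)
  · -- even class: every kernel vector has `Q = 0`
    intro heven v hv
    have hQ := Q_of_inKernel hn hv
    rw [heven] at hQ
    have hfix := monodromy_fixed_of_inKernel hn hv
    rw [monodromy_eq_dict, heven, dict_false_fixed_iff] at hfix
    have hQ0 : qtab false (sigmaSum (List.ofFn x)) (v ⟨n - 1, by omega⟩, v ⟨0, by omega⟩) = 0 := by
      rcases hfix with hS | hs
      · rw [hS]
        rcases (v ⟨n - 1, by omega⟩, v ⟨0, by omega⟩) with ⟨_ | _, _ | _⟩ <;> rfl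
      · rw [hs]; rfl
    rw [hQ0] at hQ
    obtain ⟨c2, hc2⟩ := even_wtAnd_of_inKernel' hn hv
    unfold dot2 signBit
    rw [hc2, show c2 + c2 = 2 * c2 by ring, Nat.mul_div_cancel_left _ (by norm_num : 0 < 2)]
    rw [hc2] at hQ
    set D := (univ.filter fun b : Fin n => v b = true ∧ tGuess x b = true).card
    set E := edgesIn v
    push_cast at hQ
    have h4 : ((2 * D : ℕ) : ZMod 4) = ((2 * E + 2 * c2 : ℕ) : ZMod 4) := by
      push_cast; linear_combination hQ
    have := (ZMod.natCast_eq_natCast_iff' (2 * D) (2 * E + 2 * c2) 4).1 h4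
    omega

end Summit.QuantumAdvantage.AdviceFreeQNC0
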